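import Literature.NumberTheory.Automorphic.BrandtWeightKModule
import Literature.NumberTheory.Automorphic.BrandtWeightKJacquetLanglandsProofs
import Literature.NumberTheory.Automorphic.BrandtWeightKJacquetLanglandsNewformCountProofs
import Literature.NumberTheory.Automorphic.HeckeFamilyVirtualTraceMultiplicity
import Literature.NumberTheory.EllipticCurves.EichlerBasisTheoremOfTraceIdentity
import HarnessLib

/-!
# The weight-`k` Jacquet–Langlands fact from Eichler's trace identity

Topic `Literature/NumberTheory/Automorphic`; theorems only (no named fact, no definition;
D-0026). This file PROVES that the named fact
`jacquetLanglands_newform_of_brandtEigenformLite` (`BrandtWeightKJacquetLanglands.lean`;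
Dembélé–Voight 2013 Thm. 33 / Eichler's basis problem in weight `k`) follows from the
**weight-`k` trace identity between Brandt matrices and Hecke operators** — Eichler, LNM 320
(1973), Ch. IV §1 (Theorem and its proof by induction on the primes of the level): for a definite
set-up `S` of type `(N⁺, N⁻)`, a splitting `ι : B → M₂(ℂ)`, an even weight `k > 2` and `n ≥ 1`
prime to `N⁺N⁻`,

  `tr (T(n) | M_k(O) ⊗ ℂ) = Σ_{d ∣ N⁻} μ(N⁻/d) σ₀(N⁻/d) · tr (T_n | S_k(Γ₀(d N⁺)))`,

where `M_k(O) ⊗ ℂ = Brandt.weightKFormsLite S ℂ ι k` is Eichler's space of weight-`k` forms with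
its Brandt operators `Brandt.heckeLiteW` (`BrandtWeightKModule.lean`) and the right-hand traces are
`cuspidalHeckeTrace (d N⁺) k 𝟙 n`, the left-hand side of the Eichler–Selberg trace formula
(`HeckeTraceFormulaGL2Level`). The identity is the conjunction of Eichler's trace formula for the
`B_{k-2}(n)` (LNM 320 II Thm. 5) and the Eichler–Selberg trace formula (the tree's unproved named
fact `HeckeTraceFormulaGL2Level`); it enters here as a HYPOTHESIS, stated in the tree's vocabulary,
exactly as a named fact for it would be stated (compare the weight-2 twin
`EichlerBasisTheoremOfTraceIdentity.lean`, Pizer 1980 Thm. 2.28 from his (2.8)).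

Proof (Eichler LNM 320 IV §1; Pizer 1980 p. 360; Dembélé–Voight 2013 §8):
* odd `k` is vacuous (`Brandt.not_isWeightEigenformLite_of_odd`);
* base change along an embedding `σ : F →+* ℂ` (`Brandt.map_coeffActionLite`), and truncation off
  the right ideals, turn the items' `Φ` into a non-zero simultaneous `T(q)`-eigenvector of
  Eichler's space over `ℂ` with eigenvalues `σ (lam q)` (`Brandt.heckeLite_indicator_of_prime`), so
  the simultaneous generalised eigenspace of `χ = σ ∘ lam` in `M_k(O) ⊗ ℂ` is non-zero;
* the trace identity and the virtual-multiplicity engine for COMMUTING Hecke families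
  (`finrank_iInf_maxGenEigenspace_eq_sum_of_trace_eq_sum`; the Brandt side need not be known
  semisimple) give `dim (M_k(O) ⊗ ℂ)^χ = Σ_{d ∣ N⁻} μ(N⁻/d) σ₀(N⁻/d) mult_χ S_k(Γ₀(dN⁺))`
  (on the modular side generalised eigenspaces are eigenspaces: Petersson self-adjointness);
* the Atkin–Lehner packaging `BrandtWeightK.exists_newform_of_moebius_sum_ne_zero` turns the
  non-vanishing of this Möbius sum into a newform of level `N⁻ M`, `M ∣ N⁺`, with `a_q = σ (lam q)`.

## References

* [Eichler1973] M. Eichler, *The basis problem for modular forms and the traces of the Hecke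
  operators*, LNM 320 (1973): Ch. II §6 Thm. 5 (traces of `B_l(n)`), Ch. IV §1 (the comparison).
* [DembeleVoight2013] L. Dembélé, J. Voight, *Explicit methods for Hilbert modular forms* (2013),
  Thm. 33 and §8.
* [Pizer1980] A. Pizer, J. Algebra 64 (1980), Thm. 2.28 and its proof.
* [HijikataPizerShemanske1989] H. Hijikata, A. Pizer, T. Shemanske, Mem. AMS 418 (1989), §7.
-/

noncomputable section

open scoped BigOperators MatrixGroups ModularForm ArithmeticFunction.Moebius

open CongruenceSubgroup Module Module.End UpperHalfPlane ArithmeticFunction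

namespace Literature.NumberTheory.Automorphic

open Literature.NumberTheory.EllipticCurves.ModularForms
open Literature.NumberTheory.Automorphic.HeckeTraceFormulaGL2Level

/-! ### Base change of the items' data along a field embedding -/

namespace Brandt

section BaseChange

variable {B F E : Type*} [Ring B] [Algebra ℚ B] [Field F] [Algebra ℚ F] [Field E] [Algebra ℚ E]
  (σ : F →+* E)

/-- **The substitution action commutes with base change**: for a ring map `σ : F → E`,
`σ (ρ_β P) = ρ'_β (σ P)`, where `ρ'` is the action through `σ ∘ ι : B → M₂(E)`. [folklore] -/
theorem map_coeffActionLite (ι : B →ₐ[ℚ] Matrix (Fin 2) (Fin 2) F) (β : Bˣ)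
    (P : MvPolynomial (Fin 2) F) :
    MvPolynomial.map σ (coeffActionLite ι β P) =
      coeffActionLite ((σ.toRatAlgHom.mapMatrix).comp ι) β (MvPolynomial.map σ P) := by
  rw [coeffActionLite_def, coeffActionLite_def, MvPolynomial.aeval_eq_bind₁,
    MvPolynomial.aeval_eq_bind₁, MvPolynomial.map_bind₁]
  refine congrArg (fun g => MvPolynomial.bind₁ g (MvPolynomial.map σ P)) (funext fun j => ?_)
  simp [MvPolynomial.map_X, MvPolynomial.map_C, Matrix.map_apply]

omit [Algebra ℚ F] [Algebra ℚ E] in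
/-- Base change of a scalar multiple: `σ (c • P) = σ c • σ P`. [folklore] -/
theorem map_smul_eq (c : F) (P : MvPolynomial (Fin 2) F) :
    MvPolynomial.map σ (c • P) = σ c • MvPolynomial.map σ P := by
  rw [MvPolynomial.smul_eq_C_mul, MvPolynomial.smul_eq_C_mul, map_mul, MvPolynomial.map_C]

variable {Nplus Nminus : ℕ} (S : DefiniteSetupLite Nplus Nminus)

omit [Algebra ℚ F] [Algebra ℚ E] in
/-- **Base change of the Hecke clause**: `Σ_{J ∈ nbrs} σ Φ(J) = σ (lam q) • σ Φ(I)` (the Hecke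
correspondence at a right ideal is finite, `finite_heckeNeighboursLite_of_mem`). [folklore] -/
theorem finsum_mem_heckeNeighboursLite_map {q : ℕ} (hq : q ≠ 0) {lamq : F}
    {Φ : Submodule ℤ (QuaternionAlgebra ℚ S.a 0 S.b) → MvPolynomial (Fin 2) F}
    {I : Submodule ℤ (QuaternionAlgebra ℚ S.a 0 S.b)} (hI : I ∈ rightIdealsLite S.O)
    (h : ∑ᶠ J ∈ heckeNeighboursLite S.O q I, Φ J = lamq • Φ I) :
    ∑ᶠ J ∈ heckeNeighboursLite S.O q I, MvPolynomial.map σ (Φ J) =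
      σ lamq • MvPolynomial.map σ (Φ I) := by
  rw [← map_smul_eq, ← h]
  exact ((MvPolynomial.map σ).toAddMonoidHom.map_finsum_mem Φ
    (finite_heckeNeighboursLite_of_mem hq hI)).symm

end BaseChange

/-! ### The modular side: commuting, diagonalisable -/

/-- The `T_q`, `T_{q'}` (`q, q'` prime) on `S_k(Γ₀(L))` commute. [cite: DiamondShurman2005, Prop. 5.2.4] -/
theorem commute_heckeTnGamma0_of_prime (L : ℕ) [NeZero L] (k : ℤ) {q q' : ℕ} (hq : q.Prime)
    (hq' : q'.Prime) : Commute (heckeTnGamma0 L k q) (heckeTnGamma0 L k q') := by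
  haveI : NeZero q := ⟨hq.ne_zero⟩
  haveI : NeZero q' := ⟨hq'.ne_zero⟩
  rw [heckeTnGamma0_prime L k q hq, heckeTnGamma0_prime L k q' hq']
  exact heckeT_comm_gamma0_holds L k q q'

/-- On `S_k(Γ₀(L))` the generalised eigenspaces of `T_q`, `q ∤ L` prime, are eigenspaces
(`T_q` is Petersson-self-adjoint). [cite: DiamondShurman2005, Thm. 5.5.4] -/
theorem maxGenEigenspace_heckeTnGamma0_eq_eigenspace (L : ℕ) [NeZero L] (k : ℤ) {q : ℕ}
    (hq : q.Prime) (hqL : ¬ q ∣ L) (μ₀ : ℂ) :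
    (heckeTnGamma0 L k q).maxGenEigenspace μ₀ = (heckeTnGamma0 L k q).eigenspace μ₀ := by
  haveI : FiniteDimensional ℂ (CuspForm (Gamma0 L) k) := finiteDimensional_cuspForm_gamma0 L k
  haveI : NeZero q := ⟨hq.ne_zero⟩
  rw [heckeTnGamma0_prime L k q hq]
  exact maxGenEigenspace_eq_eigenspace_of_selfAdjoint
    (fun x y ↦ peterssonProduct (Gamma0 L) k x y)
    (fun u v w ↦ peterssonProduct_add_right k u v w)
    (fun c v w ↦ peterssonProduct_smul_right (Gamma0 L) k c v w)
    (fun v w ↦ peterssonProduct_conj_symm_holds (Gamma0 L) k v w)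
    (fun v hv ↦ eq_zero_of_peterssonProduct_self_eq_zero k v hv)
    _ (fun v w ↦ heckeT_selfAdjoint_holds L k q hq hqL v w) μ₀

/-! ### The Brandt side as a Hecke family over `ℂ` -/

variable {Nplus Nminus : ℕ} (S : DefiniteSetupLite Nplus Nminus)
  (ι : QuaternionAlgebra ℚ S.a 0 S.b →ₐ[ℚ] Matrix (Fin 2) (Fin 2) ℂ) {k : ℕ}

/-- **The Brandt operators on Eichler's space form a Hecke family away from `N⁺N⁻` with constants
`c(q) = q^{k-1}`** (`k ≥ 2`): `T(1) = 1`, `T(mn) = T(m)T(n)` for coprime `m, n`, and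
`T(q^{a+2}) = T(q)T(q^{a+1}) - q^{k-1} T(q^a)` for primes `q ∤ N⁺N⁻`.
[cite: Eichler1973, Ch. II §6 Thm. 2] -/
theorem isHeckeFamily_heckeLiteW (hk : 2 ≤ k) :
    IsHeckeFamily (Nplus * Nminus) (fun p => (p : ℂ) ^ ((k : ℤ) - 1)) (heckeLiteW S ℂ ι k) where
  map_one := heckeLiteW_one
  map_mul_of_coprime hmn _ := heckeLiteW_mul_of_coprime' hmn
  map_prime_pow {q} hq hqN a := by
    have hk1 : (k : ℤ) - 1 = ((k - 1 : ℕ) : ℤ) := by omega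
    have hk2 : k - 1 = (k - 2) + 1 := by omega
    have hc : ((q : ℕ) : ℂ) ^ ((k : ℤ) - 1) = (q : ℂ) * (q : ℂ) ^ (k - 2) := by
      rw [hk1, zpow_natCast, hk2, pow_succ']
    rw [heckeLiteW_pow_add_two hq hqN a, hc]

end Brandt

/-! ### The fact from the trace identity -/

open Brandt in
/-- **Eichler's trace identity in weight `k` implies the weight-`k` Jacquet–Langlands fact for
inline Brandt eigen-systems.** If for every definite set-up `S` of type `(N⁺, N⁻)` (`N⁺ ≠ 0`
coprime to `N⁻`), every splitting `ι : B → M₂(ℂ)`, every even weight `k > 2` and every `n ≥ 1`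
prime to `N⁺N⁻`,
`tr (T(n) | weightKFormsLite S ℂ ι k) = Σ_{d ∣ N⁻} μ(N⁻/d) σ₀(N⁻/d) tr (T_n | S_k(Γ₀(dN⁺)))`
(the traces on the right being `cuspidalHeckeTrace (dN⁺) k 𝟙 n`), then
`jacquetLanglands_newform_of_brandtEigenformLite` holds. (Eichler LNM 320 IV §1: equal traces of
the Hecke operators prime to the level on both sides give the isomorphism of Hecke modules
`M_k(O) ⊗ ℂ ≅ S_k(Γ₀(N⁺N⁻))^{N⁻-new}`, whence every Brandt eigen-system is that of a newform of
level `N⁻M`, `M ∣ N⁺`; here through generalised multiplicities, strong multiplicity one and the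
Atkin–Lehner count.) [cite: Eichler1973, Ch. IV §1] [cite: DembeleVoight2013, Thm. 33]
[cite: Pizer1980, Thm. 2.28 (proof)] -/
theorem jacquetLanglands_newform_of_brandtEigenformLite_of_traceIdentity
    (hTI : ∀ (Nplus Nminus : ℕ) (S : DefiniteSetupLite Nplus Nminus)
      (ι : QuaternionAlgebra ℚ S.a 0 S.b →ₐ[ℚ] Matrix (Fin 2) (Fin 2) ℂ) (k : ℕ),
      Nplus ≠ 0 → Nplus.Coprime Nminus → 2 < k → Even k →
      ∀ (t : ℕ → ℂ) (n : ℕ), 0 < n → n.Coprime (Nplus * Nminus) →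
        (∀ (L : ℕ) [NeZero L], L ∣ Nplus * Nminus → t L = cuspidalHeckeTrace L k 1 n) →
        LinearMap.trace ℂ _ (heckeLiteW S ℂ ι k n) =
          ∑ d ∈ Nminus.divisors,
            (μ (Nminus / d) : ℂ) * ((Nminus / d).divisors.card : ℂ) * t (d * Nplus)) :
    jacquetLanglands_newform_of_brandtEigenformLite := by
  intro Nplus Nminus S F _ _ ι k lam Φ hN hcop hk hhom hequiv hhecke hne
  -- odd weight is vacuous
  have hkev : Even k := by
    by_contra hodd
    exact not_isWeightEigenformLite_of_odd ι hk.le (Nat.not_even_iff_odd.mp hodd) lam Φ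
      ⟨hhom, hequiv, hhecke, hne⟩
  -- base change along an embedding `σ : F →+* ℂ`
  obtain ⟨σ⟩ : Nonempty (F →+* ℂ) := inferInstance
  set ιC : QuaternionAlgebra ℚ S.a 0 S.b →ₐ[ℚ] Matrix (Fin 2) (Fin 2) ℂ :=
    (σ.toRatAlgHom.mapMatrix).comp ι with hιC
  set ΦC : Submodule ℤ (QuaternionAlgebra ℚ S.a 0 S.b) → MvPolynomial (Fin 2) ℂ :=
    fun I => MvPolynomial.map σ (Φ I) with hΦC
  have hhomC : ∀ I ∈ rightIdealsLite S.O, (ΦC I).IsHomogeneous (k - 2) :=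
    fun I hI => (hhom I hI).map σ
  have hequivC : ∀ (β : (QuaternionAlgebra ℚ S.a 0 S.b)ˣ), ∀ I ∈ rightIdealsLite S.O,
      ΦC (I.map (AddMonoidHom.mulLeft β.1).toIntLinearMap) = coeffActionLite ιC β (ΦC I) := by
    intro β I hI
    simp only [hΦC, hιC]
    rw [hequiv β I hI, map_coeffActionLite]
  have hneC : ∃ I ∈ rightIdealsLite S.O, ΦC I ≠ 0 := by
    obtain ⟨I, hI, hΦI⟩ := hne
    refine ⟨I, hI, fun h => hΦI (MvPolynomial.map_injective σ σ.injective ?_)⟩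
    rw [_root_.map_zero]
    exact h
  -- the truncation: a non-zero simultaneous eigenvector in Eichler's space over `ℂ`
  set Ψ : weightKFormsLite S ℂ ιC k :=
    ⟨(rightIdealsLite S.O).indicator ΦC, indicator_mem_weightKFormsLite hhomC hequivC⟩ with hΨ
  have hΨne : Ψ ≠ 0 := fun h => indicator_ne_zero (F := ℂ) hneC (congrArg Subtype.val h)
  have hΨeig : ∀ q : ℕ, q.Prime → ¬ q ∣ Nplus * Nminus →
      heckeLiteW S ℂ ιC k q Ψ = σ (lam q) • Ψ := by
    intro q hq hqN
    apply Subtype.ext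
    rw [coe_heckeLiteW_apply, Submodule.coe_smul]
    exact heckeLite_indicator_of_prime hq hqN fun I hI =>
      finsum_mem_heckeNeighboursLite_map σ S hq.ne_zero hI (hhecke q hq hqN I hI)
  -- the eigenvalue system and its generalised multiplicity in Eichler's space
  set N := Nplus * Nminus with hNdef
  let χ : PrimesNotDvd N → ℂ := fun q => σ (lam q)
  haveI : FiniteDimensional ℂ (weightKFormsLite S ℂ ιC k) := finiteDimensional_weightKFormsLite
  have hΨmem : Ψ ∈ (⨅ q : PrimesNotDvd N, (heckeLiteW S ℂ ιC k q).maxGenEigenspace (χ q) :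
      Submodule ℂ (weightKFormsLite S ℂ ιC k)) :=
    eigenChar_le_iInf_maxGenEigenspace (T := heckeLiteW S ℂ ιC k) χ
      (mem_eigenChar_iff.mpr fun q => hΨeig q q.2.1 q.2.2)
  have hWpos : (Module.finrank ℂ (⨅ q : PrimesNotDvd N,
      (heckeLiteW S ℂ ιC k q).maxGenEigenspace (χ q) :
        Submodule ℂ (weightKFormsLite S ℂ ιC k)) : ℤ) ≠ 0 := by
    intro h0
    have hbot := Submodule.finrank_eq_zero.mp (by exact_mod_cast h0)
    exact ((Submodule.ne_bot_iff _).mpr ⟨Ψ, hΨmem, hΨne⟩) hbot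
  -- the modular side, indexed by the divisors of `N⁻`
  haveI : NeZero Nplus := ⟨hN⟩
  haveI hDne : ∀ d : {d // d ∈ Nminus.divisors}, NeZero (d.1 * Nplus) := fun d =>
    ⟨mul_ne_zero (Nat.pos_of_mem_divisors d.2).ne' hN⟩
  haveI : ∀ d : {d // d ∈ Nminus.divisors}, FiniteDimensional ℂ (CuspForm (Gamma0 (d.1 * Nplus)) k) :=
    fun d => finiteDimensional_cuspForm_gamma0 _ _
  have hdvd : ∀ d : {d // d ∈ Nminus.divisors}, d.1 * Nplus ∣ N := fun d => by
    rw [hNdef, mul_comm]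
    exact mul_dvd_mul_left Nplus (Nat.dvd_of_mem_divisors d.2)
  have hVfam : ∀ d : {d // d ∈ Nminus.divisors},
      IsHeckeFamily N (fun p => (p : ℂ) ^ ((k : ℤ) - 1)) (heckeTnGamma0 (d.1 * Nplus) k) :=
    fun d => Literature.NumberTheory.EllipticCurves.BrandtJL.isHeckeFamily_of_dvd (hdvd d)
      (isHeckeFamily_heckeTnGamma0 _ _)
  have hcV : ∀ (d : {d // d ∈ Nminus.divisors}) (q q' : PrimesNotDvd N),
      Commute (heckeTnGamma0 (d.1 * Nplus) k q) (heckeTnGamma0 (d.1 * Nplus) k q') :=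
    fun d q q' => commute_heckeTnGamma0_of_prime _ _ q.2.1 q'.2.1
  have hWfam := isHeckeFamily_heckeLiteW S ιC hk.le
  have hcW : ∀ q q' : PrimesNotDvd N, Commute (heckeLiteW S ℂ ιC k q) (heckeLiteW S ℂ ιC k q') :=
    fun q q' => commute_heckeLiteW_of_prime q.2.1 q'.2.1
  -- the trace identity, in the engine's shape
  set a : {d // d ∈ Nminus.divisors} → ℤ :=
    fun d => (μ (Nminus / d.1) : ℤ) * ((Nminus / d.1).divisors.card : ℤ) with ha
  have htr : ∀ n : ℕ, 0 < n → n.Coprime N →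
      LinearMap.trace ℂ _ (heckeLiteW S ℂ ιC k n) =
        ∑ d : {d // d ∈ Nminus.divisors},
          (a d : ℂ) * LinearMap.trace ℂ _ (heckeTnGamma0 (d.1 * Nplus) k n) := by
    intro n hn hnN
    let t : ℕ → ℂ := fun L => if hL : L = 0 then 0 else
      @cuspidalHeckeTrace L ⟨hL⟩ k 1 n
    have ht : ∀ (L : ℕ) [NeZero L], L ∣ Nplus * Nminus → t L = cuspidalHeckeTrace L k 1 n :=
      fun L _ _ => dif_neg (NeZero.ne L)
    rw [hTI Nplus Nminus S ιC k hN hcop hk hkev t n hn hnN ht,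
      ← Finset.sum_coe_sort Nminus.divisors]
    refine Finset.sum_congr rfl fun d _ => ?_
    rw [trace_heckeTnGamma0, ht _ (hdvd d), ha]
    push_cast
    ring
  -- virtual multiplicities
  have key := finrank_iInf_maxGenEigenspace_eq_sum_of_trace_eq_sum hWfam hVfam hcW hcV a htr χ
  have key' : (Module.finrank ℂ (⨅ q : PrimesNotDvd N,
      (heckeLiteW S ℂ ιC k q).maxGenEigenspace (χ q) :
        Submodule ℂ (weightKFormsLite S ℂ ιC k)) : ℤ) =
      ∑ d : {d // d ∈ Nminus.divisors},
        a d * (Module.finrank ℂ (eigenChar N (heckeTnGamma0 (d.1 * Nplus) k) χ) : ℤ) := by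
    rw [key]
    refine Finset.sum_congr rfl fun d _ => ?_
    rw [iInf_maxGenEigenspace_eq_eigenChar (fun q μ₀ =>
      maxGenEigenspace_heckeTnGamma0_eq_eigenspace _ _ q.2.1
        (fun h => q.2.2 (dvd_trans h (hdvd d))) μ₀) χ]
  -- the Atkin–Lehner packaging
  let m : ℕ → ℤ := fun L => if hL : L = 0 then 0 else
    (Module.finrank ℂ (eigenChar N (@heckeTnGamma0 L ⟨hL⟩ k) χ) : ℤ)
  have hm : ∀ (L : ℕ) [NeZero L], L ∣ Nplus * Nminus →
      m L = Module.finrank ℂ (eigenChar (Nplus * Nminus) (heckeTnGamma0 L k) χ) :=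
    fun L _ _ => dif_neg (NeZero.ne L)
  have hsum : ∑ d ∈ Nminus.divisors, (μ (Nminus / d) : ℤ) * ((Nminus / d).divisors.card : ℤ) *
      m (d * Nplus) ≠ 0 := by
    rw [← Finset.sum_coe_sort Nminus.divisors]
    have hrw : ∀ d : {d // d ∈ Nminus.divisors},
        (μ (Nminus / d.1) : ℤ) * ((Nminus / d.1).divisors.card : ℤ) * m (d.1 * Nplus) =
          a d * (Module.finrank ℂ (eigenChar N (heckeTnGamma0 (d.1 * Nplus) k) χ) : ℤ) :=
      fun d => by rw [hm _ (hdvd d)]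
    simp only [hrw, ← key']
    exact hWpos
  obtain ⟨M, inst, g, hM, hg, hcoeff⟩ :=
    BrandtWeightK.exists_newform_of_moebius_sum_ne_zero Nplus Nminus (k : ℤ) S.squarefree hcop χ
      m hm hsum
  exact ⟨M, inst, g, σ, hM, hg, fun q hq hqN => hcoeff q hq hqN⟩

end Literature.NumberTheory.Automorphic

end
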